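import Literature.MathematicalPhysics.QuantumFieldTheory.Balaban1983to89.B9Ineq385Kernel
import Literature.MathematicalPhysics.QuantumFieldTheory.Balaban1983to89.B9Ineq385V3Concrete

/-!
# `Balaban1983to89.B9Ineq385KernelConcrete` — [Balaban1985BackgroundPropagators] (3.85) p. 407 WITH THE KERNEL BOUND `(L^{j′}η)^{−d}` ON THE
# RIGHT LETTER, (i) summed over the gradient letters `k ∈ s` (`ineq385_kernel_sum`, generic carrier) and (ii) FOR THE CONCRETE `V₃(A)` OF (3.82)
# (`ineq385_kernel_concreteV₃`: the `V₃`-side discharged by `B9Eq382V3Letters.conj_V₃Op_eq_gradForm` / `hasMajorant_V₃_zero` / `hasMajorant_V₃_one`,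
# exactly as FILE 8's majorant form `B9Ineq385V3Concrete.ineq385_op_concreteV₃`) — FILE 23 of the Sect. B programme of cell `lit-balaban`, seat r06
# (B9 fold owner) gen 13; step 2 of the RECIPE in FILE 22's header for the kernel-form entries of Theorem 3.4

statement-level skeleton of published theorems with citation tags; proofs where landed; nothing here is a claim about the Yang–Mills mass gap

CITATION HEADER (lean-in-tree rule).  B9 = T. Bałaban, *Propagators for lattice gauge theories in a background field*, Commun. Math. Phys. **99** (1985)
389–434 (journal page = PDF page + 388).  p. 407 [PDF 19]: «Using the bounds (3.73), (3.77), (3.83) and assuming that Theorem 3.3 holds for G(U), we get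
|(V(A)G(U)J)(b)| ≦ O(1)α₁e^{−(1/2)δ₀d(y,y′)}|J| for b ∈ Δ(y), supp J ⊂ Δ(y′). (3.85) … the local ones follow from the bound (3.85) and Lemma 2.1 [4].»
(3.73) p. 405, (3.82) p. 407 (the concrete `V₃(A)`), (3.42) p. 397 (the printed kernel shape, `B6RandomWalkKernel.HasKernelBound`).  [4] =
[Balaban1984PropagatorsII] (2.51)–(2.55) p. 232, Lemma 2.1 p. 234.  Rows B9.Eq3.85 × B9.Eq3.73 × B9.Thm3.4 (cells only).

WHAT IS PROVED (0 `def`, 0 sorry).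
* §1 `eq386_resolvent_of_inverses` ((3.84) + the two inverse identities ⇒ `G(U′U) = G(U) + G(U′U)·(V(A)G(U))`, the `h386` input of FILE 22, any ring);
  (generic carrier `W`, `blk : W → 𝔅`, geometry `toB6 g R H`): `hasKernelBound_zero`, `hasKernelBound_finsetSum`, `hasKernelBound_sum_const` («a summation
  preserves it also», [4] p. 232, for kernel bounds); **`ineq385_kernel_sum`** — FILE 22's `ineq385_kernel` with the first-order part summed over letters,
  `V₃ = V⁰ + Σ_{k∈s} V¹_k·D_k`, `V¹_k ≺ c_{1,k}α₁(Lʲη)^{−1}e^{−δd}`, `Σ_k c_{1,k} ≦ c_V`, kernel inputs `|T(x,x′)| ≦ B₀w(y)e^{−δd}v⁻¹`,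
  `|(D_kT)(x,x′)| ≦ B₀w(y)(Lʲη)^{−1}e^{−δd}v⁻¹` (`k ∈ s`): `|(V(A)T)(x,x′)| ≦ κ₃₈₅·α₁·(Lʲη)^{−2}w(y)·e^{−ρd}·v(y′)⁻¹`, `κ₃₈₅ = B9Ineq385VG.kappa385`;
  **`gExt_kernelEntry_explicit`** — the kernel twin of FILE 7's `gExt_leftEntry_explicit` with a right letter `Y`: under Theorem 3.4's threshold
  `α₁ ≦ (2κ₀B₀c₁(ρ,α′))⁻¹`, from (3.85) (majorant for `V(A)G(U)`, kernel for `V(A)G(U)Y`) and Theorem 3.3's entries (majorant for `X·G(U)`, kernel for `X·G(U)·Y`),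
  `|(X·G(U′U)·Y)(x,x′)| ≦ (B₀′ + 2B₀c₁(ρ,α′)θΛ_Qc₁(δ₀,β))·P(y)Q(y)·e^{−ρ″d}·v(y′)⁻¹` — all four entries of (3.42) for `G(U′U)` in the printed kernel form.
* §2 (the concrete bond carrier `(κ × S) × ι` of FILES 1–20, group-valued background `U`, `η = g.eta`): **`ineq385_kernel_concreteV₃`** — (3.85) in
  kernel-on-the-right form for `V(A) = V₃(A) + P₁ + P₂` with the CONCRETE `V₃(A)` of (3.82) (`conj b (V₃Op T U η A)`), abstract `P₁`, `P₂` with their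
  (3.77)/(3.83) majorants, and a right factor `T` with weight `w` carrying Theorem 3.3's KERNEL bounds (print: `T = G(U)`, `w = (Lʲη)²`; `T = G(U)∇*`,
  `w = Lʲη`); constant `kappa385 B₀ (cV385 d α₁ C₀ M) κ₁ κ₂ Λ c₁(β)` — the same as the majorant form.

HONEST SCOPE / NOT CLAIMED.  As FILE 8: the (3.37)/(3.35) sizes, the stencil geometry, Lemma 2.1 (as `Ineq261` + `ScaleTransfer`), `P₁`, `P₂` and Theorem
3.3's kernel bounds are hypotheses; the remaining steps of the RECIPE (the concrete `P₁(A)` of FILE 12 at FILE 20's rates, the resolvent identity for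
FILE 20's `G(U′U)`, and `B9Ineq385Kernel.gExt_kernelEntry_of_386` per entry) are successor plumbing.
-/

noncomputable section

namespace Literature.MathematicalPhysics.QuantumFieldTheory.Balaban1983to89.B9Ineq385KernelConcrete

open NormedSpace Complex
open Literature.MathematicalPhysics.QuantumFieldTheory.Balaban1983to89
open Literature.MathematicalPhysics.QuantumFieldTheory.Balaban1983to89.B6RandomWalk (HasMajorant hasMajorant_mono Triangle254 Ineq261)
open Literature.MathematicalPhysics.QuantumFieldTheory.Balaban1983to89.B6RandomWalkKernel (ker HasKernelBound hasKernelBound_add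
  hasKernelBound_mono)
open Literature.MathematicalPhysics.QuantumFieldTheory.Balaban1983to89.B9Thm34Ext (toB6)
open Literature.MathematicalPhysics.QuantumFieldTheory.Balaban1983to89.B9Ineq347 (ScaleTransfer)
open Literature.MathematicalPhysics.QuantumFieldTheory.Balaban1983to89.B9Eq386Neumann (vTotal)
open Literature.MathematicalPhysics.QuantumFieldTheory.Balaban1983to89.B9Ineq385VG (kappa385)
open Literature.MathematicalPhysics.QuantumFieldTheory.Balaban1983to89.B9Ineq385Kernel (hasKernelBound_rate_mono hasKernelBound_comp_decay)
open Literature.MathematicalPhysics.QuantumFieldTheory.Balaban1983to89.B9Ineq385V3Concrete (cV385 cV385_nonneg cV0_nonneg)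
open Literature.MathematicalPhysics.QuantumFieldTheory.Balaban1983to89.B9Eq39Adjoint
open Literature.MathematicalPhysics.QuantumFieldTheory.Balaban1983to89.B9Eq369Small (Through)
open Literature.MathematicalPhysics.QuantumFieldTheory.Balaban1983to89.B9Eq372Locality (stBonds)
open Literature.MathematicalPhysics.QuantumFieldTheory.Balaban1983to89.B9Eq352DivForm (tauF tauB)
open Literature.MathematicalPhysics.QuantumFieldTheory.Balaban1983to89.B9Eq352DivFormLetters
open Literature.MathematicalPhysics.QuantumFieldTheory.Balaban1983to89.B9Eq352GradLetters (diffLetter)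
open Literature.MathematicalPhysics.QuantumFieldTheory.Balaban1983to89.B9Eq371GradLetters (bT bU zeroLetter V1Letter)
open Literature.MathematicalPhysics.QuantumFieldTheory.Balaban1983to89.B9Eq375GradLetters (zeroLetter₂ V1Letter₂)
open Literature.MathematicalPhysics.QuantumFieldTheory.Balaban1983to89.B9Eq372RemLetters
open Literature.MathematicalPhysics.QuantumFieldTheory.Balaban1983to89.B9Eq382V3Letters

/-! ## §1  Summation of kernel bounds; (3.85) in kernel form with the gradient letters summed -/

/-- **(3.84) + two-sided inverses ⇒ the resolvent form of (3.86)** used by `B9Ineq385Kernel.gExt_kernelEntry_of_386` (its hypothesis `h386`): if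
`Δ_a(U)G(U) = 1`, `G(U′U)Δ_a(U′U) = 1` and `Δ_a(U′U) = Δ_a(U) − V(A)` ((3.84)), then `G(U′U) = G(U) + G(U′U)·(V(A)G(U))` — ring algebra
(`G(U′U) = G(U′U)Δ_a(U′U)G(U) + G(U′U)V(A)G(U)`); for the concrete operators of `B9Thm34GFinal.thm34_G_clause_final` the three inputs are its `hΔG`,
the fourth conjunct of its conclusion, and `B9Eq386Neumann`'s (3.82)/(3.84) bookkeeping.
[cite: Balaban1985BackgroundPropagators, (3.84) + (3.86) p.407] -/
theorem eq386_resolvent_of_inverses {Rg : Type*} [Ring Rg] {Δ Δ' V G GExt : Rg} (hΔG : Δ * G = 1) (hE : GExt * Δ' = 1)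
    (h384 : Δ' = Δ - V) : GExt = G + GExt * (V * G) := by
  have h1 : GExt * Δ' * G = G := by rw [hE, one_mul]
  have h2 : GExt * Δ' * G = GExt * (Δ * G) - GExt * (V * G) := by rw [h384]; noncomm_ring
  rw [hΔG, mul_one] at h2
  have hkey : GExt - GExt * (V * G) = G := h2.symm.trans h1
  calc GExt = (GExt - GExt * (V * G)) + GExt * (V * G) := by abel
    _ = G + GExt * (V * G) := by rw [hkey]

section Generic

variable {g : B9.Geometry} [Fintype g.Site] {R : ℝ} {H : Prop} {W : Type} [Fintype W] [DecidableEq W] {K : Type}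

omit [Fintype W] in
/-- The zero operator has the zero kernel bound. [folklore] [cite: Balaban1984PropagatorsII, (2.55) p.232] -/
theorem hasKernelBound_zero (blk : W → g.Site) (v : g.Site → ℝ) (c : ℝ) :
    HasKernelBound (g := toB6 g R H) blk v c (0 : Module.End ℝ (W → ℝ)) (fun _ _ => 0) := by
  intro x x'
  simp [ker]

omit [Fintype W] in
/-- **«A summation preserves it also»** ([4] p. 232) for kernel bounds: `|T_k(x,x′)| ≦ K_k(y,y′)v⁻¹` (`k ∈ s`) ⟹ `|(Σ_kT_k)(x,x′)| ≦ (Σ_kK_k)(y,y′)v⁻¹`.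
[cite: Balaban1984PropagatorsII, (2.52)–(2.55) p.232] -/
theorem hasKernelBound_finsetSum [DecidableEq K] (blk : W → g.Site) (v : g.Site → ℝ) (c : ℝ) (s : Finset K)
    (T : K → Module.End ℝ (W → ℝ)) (Kf : K → g.Site → g.Site → ℝ)
    (h : ∀ k ∈ s, HasKernelBound (g := toB6 g R H) blk v c (T k) (Kf k)) :
    HasKernelBound (g := toB6 g R H) blk v c (∑ k ∈ s, T k) (fun a b => ∑ k ∈ s, Kf k a b) := by
  induction s using Finset.induction_on with
  | empty => simpa using hasKernelBound_zero (R := R) (H := H) blk v c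
  | @insert k s hk ih =>
    rw [Finset.sum_insert hk]
    have h' := hasKernelBound_add (g := toB6 g R H) blk (h k (Finset.mem_insert_self k s))
      (ih fun k' hk' => h k' (Finset.mem_insert_of_mem hk'))
    simpa [Finset.sum_insert hk] using h'

omit [Fintype W] in
/-- Summation with a common shape: `|T_k(x,x′)| ≦ c_k·w(y,y′)v⁻¹` ⟹ `|(Σ_kT_k)(x,x′)| ≦ (Σ_kc_k)·w(y,y′)v⁻¹`. [cite: Balaban1984PropagatorsII, (2.52)–(2.55) p.232] -/
theorem hasKernelBound_sum_const [DecidableEq K] (blk : W → g.Site) {v : g.Site → ℝ} (hv : ∀ y, 0 < v y) (c : ℝ) (s : Finset K)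
    (cf : K → ℝ) (w : g.Site → g.Site → ℝ) {T : K → Module.End ℝ (W → ℝ)}
    (h : ∀ k ∈ s, HasKernelBound (g := toB6 g R H) blk v c (T k) (fun a b => cf k * w a b)) :
    HasKernelBound (g := toB6 g R H) blk v c (∑ k ∈ s, T k) (fun a b => (∑ k ∈ s, cf k) * w a b) := by
  refine hasKernelBound_mono (g := toB6 g R H) blk hv
    (hasKernelBound_finsetSum (R := R) (H := H) blk v c s T (fun k a b => cf k * w a b) h) fun a b => le_of_eq ?_
  rw [Finset.sum_mul]

/-- **(3.85) IN KERNEL FORM, GRADIENT LETTERS SUMMED** (the kernel twin of `B9Ineq386CommSum.ineq385_op_sum`): `V(A) = V₃ + P₁ + P₂`,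
`V₃ = V⁰ + Σ_{k∈s}V¹_k·D_k`, `V⁰ ≺ c_Vα₁(Lʲη)^{−2}e^{−δd}`, `V¹_k ≺ c_{1,k}α₁(Lʲη)^{−1}e^{−δd}` with `Σ_kc_{1,k} ≦ c_V`, `P₁ ≺ κ₁α₁(Lʲη)^{−2}e^{−δd}`,
`P₂ ≺ κ₂α₁(Lʲη)^{−2}e^{−δd}`, and a right factor `T` with `|T(x,x′)| ≦ B₀w(y)e^{−δd}v⁻¹`, `|(D_kT)(x,x′)| ≦ B₀w(y)(Lʲη)^{−1}e^{−δd}v⁻¹`: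
`|(V(A)T)(x,x′)| ≦ κ₃₈₅·α₁·(Lʲη)^{−2}w(y)·e^{−ρd(y,y′)}·v(y′)⁻¹` (`ρ + (α+β)δ₀ ≦ δ`; scale transfers `Λ` for `w`, `w·(Lʲη)^{−1}`).
[cite: Balaban1985BackgroundPropagators, (3.84)–(3.85) p.407 + (3.73) p.405 + (3.77) p.406 + (3.83) p.407 + (3.42) p.397; Balaban1984PropagatorsII, (2.52)–(2.55) p.232 + Lemma 2.1 p.234] -/
theorem ineq385_kernel_sum [DecidableEq K] (blk : W → g.Site) (d : ℕ) (s : Finset K) (δ₀ δ α β ρ Λ B₀ cV κ₁ κ₂ α₁ : ℝ) (c1 : K → ℝ)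
    (w : g.Site → ℝ)
    (hB₀ : 0 ≤ B₀) (hcV : 0 ≤ cV) (hκ₁ : 0 ≤ κ₁) (hκ₂ : 0 ≤ κ₂) (hα₁ : 0 ≤ α₁) (hΛ : 0 ≤ Λ) (hρ : 0 ≤ ρ)
    (hα : 0 ≤ α) (hβ : 0 ≤ β) (hδ₀ : 0 ≤ δ₀) (hr : ρ + (α + β) * δ₀ ≤ δ) (hw : ∀ a, 0 ≤ w a)
    (hc1 : ∀ k ∈ s, 0 ≤ c1 k) (hsum : ∑ k ∈ s, c1 k ≤ cV)
    (hdnn : ∀ a b : g.Site, 0 ≤ g.dist a b) (htri : Triangle254 (toB6 g R H)) (hlen : ∀ y : g.Site, 0 < g.len y)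
    (h261 : Ineq261 d (toB6 g R H) δ₀ β)
    (hT1 : ScaleTransfer g δ₀ α Λ w) (hT2 : ScaleTransfer g δ₀ α Λ (fun a => w a * (g.len a)⁻¹))
    {v : g.Site → ℝ} (hv : ∀ y, 0 < v y) {c : ℝ} (hc : 0 < c)
    {T V₃ V0 P₁ P₂ : Module.End ℝ (W → ℝ)} {V1 D : K → Module.End ℝ (W → ℝ)} (hV₃ : V₃ = V0 + ∑ k ∈ s, V1 k * D k)
    (hV0 : HasMajorant (g := toB6 g R H) blk V0 (fun a b => cV * α₁ * (g.len a ^ 2)⁻¹ * Real.exp (-(δ * g.dist a b))))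
    (hV1 : ∀ k ∈ s, HasMajorant (g := toB6 g R H) blk (V1 k) (fun a b => c1 k * α₁ * (g.len a)⁻¹ * Real.exp (-(δ * g.dist a b))))
    (hP₁ : HasMajorant (g := toB6 g R H) blk P₁ (fun a b => κ₁ * α₁ * (g.len a ^ 2)⁻¹ * Real.exp (-(δ * g.dist a b))))
    (hP₂ : HasMajorant (g := toB6 g R H) blk P₂ (fun a b => κ₂ * α₁ * (g.len a ^ 2)⁻¹ * Real.exp (-(δ * g.dist a b))))
    (hT : HasKernelBound (g := toB6 g R H) blk v c T (fun a b => B₀ * w a * Real.exp (-(δ * g.dist a b))))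
    (hDT : ∀ k ∈ s, HasKernelBound (g := toB6 g R H) blk v c (D k * T)
      (fun a b => B₀ * (w a * (g.len a)⁻¹) * Real.exp (-(δ * g.dist a b)))) :
    HasKernelBound (g := toB6 g R H) blk v c (vTotal V₃ P₁ P₂ * T)
      (fun a b => kappa385 B₀ cV κ₁ κ₂ Λ (B6.c1 d δ₀ β) * α₁ * ((g.len a ^ 2)⁻¹ * w a) * Real.exp (-(ρ * g.dist a b))) := by
  set cc : ℝ := B6.c1 d δ₀ β with hc_def
  have hc0 : 0 ≤ cc := B6RandomWalk.c1_nonneg d δ₀ β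
  have hw1i : ∀ a : g.Site, 0 ≤ (g.len a)⁻¹ := fun a => inv_nonneg.mpr (hlen a).le
  have hw2i : ∀ a : g.Site, 0 ≤ (g.len a ^ 2)⁻¹ := fun a => inv_nonneg.mpr (sq_nonneg _)
  have hwl : ∀ a : g.Site, 0 ≤ w a * (g.len a)⁻¹ := fun a => mul_nonneg (hw a) (hw1i a)
  have hcVα : 0 ≤ cV * α₁ := mul_nonneg hcV hα₁
  have hκ₁α : 0 ≤ κ₁ * α₁ := mul_nonneg hκ₁ hα₁
  have hκ₂α : 0 ≤ κ₂ * α₁ := mul_nonneg hκ₂ hα₁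
  have hρδ : ρ ≤ δ := by
    have : 0 ≤ (α + β) * δ₀ := by positivity
    linarith
  have hTρ := hasKernelBound_rate_mono (R := R) (H := H) blk hv c B₀ w hB₀ hw hρδ hdnn hT
  -- the words V⁰T, P₁T, P₂T
  have w1 := hasKernelBound_comp_decay (R := R) (H := H) blk d δ₀ α β ρ δ Λ (cV * α₁) B₀ (fun a => (g.len a ^ 2)⁻¹) w
    hw2i hw hΛ hcVα hB₀ hρ hr hdnn htri hT1 h261 hv hc hV0 hTρ
  have w3 := hasKernelBound_comp_decay (R := R) (H := H) blk d δ₀ α β ρ δ Λ (κ₁ * α₁) B₀ (fun a => (g.len a ^ 2)⁻¹) w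
    hw2i hw hΛ hκ₁α hB₀ hρ hr hdnn htri hT1 h261 hv hc hP₁ hTρ
  have w4 := hasKernelBound_comp_decay (R := R) (H := H) blk d δ₀ α β ρ δ Λ (κ₂ * α₁) B₀ (fun a => (g.len a ^ 2)⁻¹) w
    hw2i hw hΛ hκ₂α hB₀ hρ hr hdnn htri hT1 h261 hv hc hP₂ hTρ
  -- the words V¹_k(D_kT), summed
  have w2k : ∀ k ∈ s, HasKernelBound (g := toB6 g R H) blk v c (V1 k * (D k * T))
      (fun a b => (c1 k * α₁ * B₀ * Λ * cc) * (((g.len a)⁻¹ * (w a * (g.len a)⁻¹)) * Real.exp (-(ρ * g.dist a b)))) := by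
    intro k hk
    have hDTρ := hasKernelBound_rate_mono (R := R) (H := H) blk hv c B₀ (fun a => w a * (g.len a)⁻¹) hB₀ hwl hρδ hdnn (hDT k hk)
    have h := hasKernelBound_comp_decay (R := R) (H := H) blk d δ₀ α β ρ δ Λ (c1 k * α₁) B₀ (fun a => (g.len a)⁻¹)
      (fun a => w a * (g.len a)⁻¹) hw1i hwl hΛ (mul_nonneg (hc1 k hk) hα₁) hB₀ hρ hr hdnn htri hT2 h261 hv hc (hV1 k hk) hDTρ
    exact hasKernelBound_mono (g := toB6 g R H) blk hv h fun a b => le_of_eq (by rw [← hc_def]; ring)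
  have w2 := hasKernelBound_sum_const (R := R) (H := H) blk hv c s (fun k => c1 k * α₁ * B₀ * Λ * cc)
    (fun a b => ((g.len a)⁻¹ * (w a * (g.len a)⁻¹)) * Real.exp (-(ρ * g.dist a b))) w2k
  have hsum' := hasKernelBound_add (g := toB6 g R H) blk
    (hasKernelBound_add (g := toB6 g R H) blk (hasKernelBound_add (g := toB6 g R H) blk w1 w2) w3) w4
  have e : vTotal V₃ P₁ P₂ * T = V0 * T + (∑ k ∈ s, V1 k * (D k * T)) + P₁ * T + P₂ * T := by
    rw [vTotal, hV₃]
    simp only [add_mul, Finset.sum_mul, mul_assoc]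
  rw [e]
  refine hasKernelBound_mono (g := toB6 g R H) blk hv hsum' fun a b => ?_
  have ha : g.len a ≠ 0 := (hlen a).ne'
  have h1 : (g.len a)⁻¹ * (w a * (g.len a)⁻¹) = (g.len a ^ 2)⁻¹ * w a := by
    field_simp
  have hS : (∑ k ∈ s, c1 k * α₁ * B₀ * Λ * cc) ≤ cV * α₁ * B₀ * Λ * cc := by
    rw [← Finset.sum_mul, ← Finset.sum_mul, ← Finset.sum_mul, ← Finset.sum_mul]
    have : 0 ≤ α₁ * B₀ * Λ * cc := by positivity
    have := mul_le_mul_of_nonneg_right hsum this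
    nlinarith
  have hE : 0 ≤ (g.len a ^ 2)⁻¹ * w a * Real.exp (-(ρ * g.dist a b)) := mul_nonneg (mul_nonneg (hw2i a) (hw a)) (Real.exp_nonneg _)
  rw [h1]
  simp only [kappa385]
  nlinarith [mul_le_mul_of_nonneg_right hS hE]

/-- **THE ENTRIES OF (3.42) FOR `G(U′U)` IN KERNEL FORM, WITH THEOREM 3.4's EXPLICIT THRESHOLD** (the kernel twin of FILE 7's
`B9Ineq385VG.gExt_leftEntry_explicit`, with a right letter `Y`): under `α₁ ≦ (2κ₀B₀c₁(ρ,α′))⁻¹`, from the resolvent form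
`G(U′U) = G(U) + G(U′U)·(V(A)G(U))`, (3.85) as a MAJORANT (`V(A)G(U) ≺ κ₀B₀α₁e^{−ρd}`, `ineq385_op`) and in KERNEL form for the right factor `G(U)·Y`
(`|(V(A)G(U)Y)(x,x′)| ≦ θQ(y)e^{−ρ″d}v⁻¹`, `ineq385_kernel(_sum/_concreteV₃)` with `T = G(U)·Y`), Theorem 3.3's `X`-entry as a majorant (`B₀P(y)e^{−ρd}`) and
its `(X,Y)`-entry as a kernel bound (`B₀′P(y)Q(y)e^{−rd}v⁻¹`), the scale transfer `Λ_Q` for `Q`: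
`|(X·G(U′U)·Y)(x,x′)| ≦ (B₀′ + 2B₀c₁(ρ,α′)·θ·Λ_Q·c₁(δ₀,β))·P(y)Q(y)·e^{−ρ″d(y,y′)}·v(y′)⁻¹` for `ρ″ ≦ r`, `ρ″ + (α+β)δ₀ ≦ (1−α′)ρ` — the majorant of
`X·G(U′U)` is FILE 7's, the kernel step is FILE 22's `gExt_kernelEntry_of_386`.  Entries: `(X,Y,P·Q) = (1,1,(Lʲη)²)`, `(∇,1,Lʲη)`, `(1,∇*,Lʲη)`, `(∇,∇*,1)`.
[cite: Balaban1985BackgroundPropagators, Thm 3.4 p.400 + (3.85)–(3.86) p.407 + (3.42) p.397; Balaban1984PropagatorsII, (2.66) p.234 + Lemma 2.1 p.234] -/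
theorem gExt_kernelEntry_explicit (blk : W → g.Site) (d : ℕ) (δ₀ α β ρ ρ'' r α' κ₀ B₀ B₀' α₁ θ Λq : ℝ) (P Q : g.Site → ℝ)
    (hB₀ : 0 < B₀) (hB₀' : 0 ≤ B₀') (hκ₀ : 0 < κ₀) (hα₁ : 0 ≤ α₁) (hθ : 0 ≤ θ) (hΛq : 0 ≤ Λq) (hP : ∀ y, 0 ≤ P y) (hQ : ∀ y, 0 ≤ Q y)
    (hρ : 0 ≤ ρ) (hρ'' : 0 ≤ ρ'') (hα' : α' ≤ 1) (hα'ρ : 0 ≤ (1 - α') * ρ) (hc₁ : 0 < B6.c1 d ρ α')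
    (hr'' : ρ'' + (α + β) * δ₀ ≤ (1 - α') * ρ) (hρ''r : ρ'' ≤ r)
    (htri : Triangle254 (toB6 g R H)) (hrefl : ∀ y : g.Site, g.dist y y = 0)
    (hdnn : ∀ y y' : g.Site, 0 ≤ g.dist y y') (h261ρ : Ineq261 d (toB6 g R H) ρ α') (h261β : Ineq261 d (toB6 g R H) δ₀ β)
    (hST : ScaleTransfer g δ₀ α Λq Q) (ha₁ : α₁ ≤ (2 * κ₀ * B₀ * B6.c1 d ρ α')⁻¹)
    {v : g.Site → ℝ} (hv : ∀ y, 0 < v y) {c : ℝ} (hc : 0 < c)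
    {X Y GU GExt VG : Module.End ℝ (W → ℝ)} (h386 : GExt = GU + GExt * VG)
    (h342X : HasMajorant (g := toB6 g R H) blk (X * GU) (fun a b => B₀ * P a * Real.exp (-(ρ * g.dist a b))))
    (h342XYk : HasKernelBound (g := toB6 g R H) blk v c (X * GU * Y) (fun a b => B₀' * (P a * Q a) * Real.exp (-(r * g.dist a b))))
    (h385 : HasMajorant (g := toB6 g R H) blk VG (fun a b => κ₀ * B₀ * α₁ * Real.exp (-(ρ * g.dist a b))))
    (h385Yk : HasKernelBound (g := toB6 g R H) blk v c (VG * Y) (fun a b => θ * Q a * Real.exp (-(ρ'' * g.dist a b)))) :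
    HasKernelBound (g := toB6 g R H) blk v c (X * GExt * Y)
      (fun a b => (B₀' + 2 * B₀ * B6.c1 d ρ α' * θ * Λq * B6.c1 d δ₀ β) * (P a * Q a) * Real.exp (-(ρ'' * g.dist a b))) := by
  -- the majorant of X·G(U′U) (FILE 7)
  have hM := B9Ineq385VG.gExt_leftEntry_explicit (R := R) (H := H) blk d ρ α' κ₀ B₀ α₁ P hB₀ hκ₀ hα₁ hP hρ hα' hα'ρ hc₁ htri hrefl
    hdnn h261ρ ha₁ h342X h385 h386
  have h2B : 0 ≤ 2 * B₀ * B6.c1 d ρ α' := by positivity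
  exact B9Ineq385Kernel.gExt_kernelEntry_of_386 (R := R) (H := H) blk d δ₀ α β ρ'' r ((1 - α') * ρ) Λq B₀' (2 * B₀ * B6.c1 d ρ α') θ
    P Q hB₀' h2B hθ hP hQ hΛq hρ'' hr'' hρ''r hdnn htri hST h261β hv hc h386 h342XYk hM h385Yk

end Generic

/-! ## §2  (3.85) in kernel form for the CONCRETE `V₃(A)` of (3.82) -/

section Concrete

variable {𝔸 : Type*} [NormedRing 𝔸] [NormedAlgebra ℂ 𝔸] [CompleteSpace 𝔸] {ι : Type} [Fintype ι] [DecidableEq ι]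
variable (b : Module.Basis ι ℝ 𝔸) {S : Type} [Fintype S] [DecidableEq S] {κ : Type} [Fintype κ] [LinearOrder κ]
variable (T : κ → Equiv.Perm S) (U : κ → S → 𝔸ˣ)
variable {g : B9.Geometry} [Fintype g.Site] {Rr : ℝ} {H : Prop}

/-- **(3.85) WITH THE KERNEL BOUND ON THE RIGHT LETTER, FOR THE CONCRETE `V₃(A)` OF (3.82)** — `ineq385_kernel_sum` with its `V₃`-side hypotheses
DISCHARGED as in FILE 8: `hV₃` := `conj_V₃Op_eq_gradForm` (the `2d` letters `k ∈ κ ⊕ κ`), `hV0` := `hasMajorant_V₃_zero`, `hV1` := `hasMajorant_V₃_one`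
(`c_{1,k} = 14(d+1)M`).  Remaining inputs: group-valued `U` with (3.35) on the plaquettes through each bond, (3.37) for `A` blockwise on the stencils,
`η = g.eta` with `η·α₁(Lʲη)⁻¹ ≦ 1/4`, the stencil geometry, the device's geometry ((2.54), (2.61) of [4], the scale transfers for `w`, `w·(Lʲη)^{−1}`,
`ρ + (α+β)δ₀ ≦ δ`), abstract `P₁`, `P₂` with their (3.77)/(3.83)-majorants, and a right factor `Tr` with Theorem 3.3's KERNEL bounds
`|Tr(x,x′)| ≦ B₀w(y)e^{−δd}v⁻¹`, `|(∇_kTr)(x,x′)| ≦ B₀w(y)(Lʲη)^{−1}e^{−δd}v⁻¹` for each letter (print: `Tr = G(U)`, `w = (Lʲη)²`).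
CONCLUSION: `|(V(A)Tr)(x,x′)| ≦ κ₃₈₅·α₁·(Lʲη)^{−2}w(y)·e^{−ρd(y,y′)}·v(y′)⁻¹`, `κ₃₈₅` at `c_V = cV385 d α₁ C₀ (M₂(Σ‖b_i‖)e^{δd₀})` — the constant of the
majorant form `B9Ineq385V3Concrete.ineq385_op_concreteV₃`.
[cite: Balaban1985BackgroundPropagators, (3.84)–(3.85) p.407 + (3.73) p.405 + (3.82) p.407 + (3.42) p.397; Balaban1984PropagatorsII, (2.51)–(2.55) p.232 + Lemma 2.1 p.234] -/
theorem ineq385_kernel_concreteV₃ (blk : S → g.Site) (d : ℕ) (δ₀ δ α β ρ Λ B₀ κ₁ κ₂ α₁ C₀ d₀ M₂ : ℝ) (w : g.Site → ℝ)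
    (hB₀ : 0 ≤ B₀) (hκ₁ : 0 ≤ κ₁) (hκ₂ : 0 ≤ κ₂) (hα₁ : 0 ≤ α₁) (hC₀ : 0 ≤ C₀) (hΛ : 0 ≤ Λ) (hρ : 0 ≤ ρ)
    (hα : 0 ≤ α) (hβ : 0 ≤ β) (hδ₀ : 0 ≤ δ₀) (hδ : 0 ≤ δ) (hM₂ : 0 ≤ M₂) (hr : ρ + (α + β) * δ₀ ≤ δ) (hw : ∀ a, 0 ≤ w a)
    (hdnn : ∀ a a' : g.Site, 0 ≤ g.dist a a') (htri : Triangle254 (toB6 g Rr H)) (hlen : ∀ y : g.Site, 0 < g.len y)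
    (h261 : Ineq261 d (toB6 g Rr H) δ₀ β)
    (hT1 : ScaleTransfer g δ₀ α Λ w) (hT2 : ScaleTransfer g δ₀ α Λ (fun a => w a * (g.len a)⁻¹))
    (hrepr : ∀ (v : 𝔸) (i : ι), |b.repr v i| ≤ M₂ * ‖v‖) (hη : 0 < g.eta) (hL : 1 ≤ g.L) (A : κ → S → 𝔸)
    (hsmall : ∀ y : g.Site, g.eta * (α₁ * (g.len y)⁻¹) ≤ 1 / 4)
    (hU1 : ∀ m z, ‖((U m z : 𝔸ˣ) : 𝔸)‖ ≤ 1 ∧ ‖(((U m z)⁻¹ : 𝔸ˣ) : 𝔸)‖ ≤ 1)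
    (h337B : ∀ ν k x, ‖((g.eta : ℂ)⁻¹) • covDstar T U ν (A k) x‖ ≤ α₁ * (g.len (blk x) ^ 2)⁻¹)
    (h337F : ∀ μ ν x, ‖((g.eta : ℂ)⁻¹) • covD T U μ (A ν) x‖ ≤ α₁ * (g.len (blk x) ^ 2)⁻¹)
    (h337B' : ∀ μ ν x, ‖((g.eta : ℂ)⁻¹) • covDstar T U ν (A ν) (T μ x)‖ ≤ α₁ * (g.len (blk x) ^ 2)⁻¹)
    (hA : ∀ k x, ‖A k x‖ ≤ α₁ * (g.len (blk x))⁻¹) (hAτB : ∀ ν k x, ‖tauB T U ν (A k) x‖ ≤ α₁ * (g.len (blk x))⁻¹)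
    (hAτF : ∀ μ k x, ‖tauF T U μ (A k) x‖ ≤ α₁ * (g.len (blk x))⁻¹)
    (hAst : ∀ μ x m z, (m, z) ∈ stBonds T μ x → ‖A m z‖ ≤ α₁ * (g.len (blk x))⁻¹)
    (hAloc : ∀ μ x m z, (m, z) ∈ B9Eq375Locality.locBondsA T μ x → ‖A m z‖ ≤ α₁ * (g.len (blk x))⁻¹)
    (hdAst : ∀ μ x m n y, Through T μ x m n y →
      ‖covD T U m (A n) y‖ ≤ g.eta * (α₁ * ((g.len (blk x))⁻¹) ^ 2) ∧
        ‖covD T U n (A m) y‖ ≤ g.eta * (α₁ * ((g.len (blk x))⁻¹) ^ 2))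
    (h35 : ∀ μ x m n y, Through T μ x m n y → ‖(plaqU T U m n y : 𝔸) - 1‖ ≤ C₀ * ((g.L ^ g.scale (blk x))⁻¹) ^ 2)
    (hd₀B : ∀ μ x, g.dist (blk x) (blk ((T μ).symm x)) ≤ d₀) (hd₀F : ∀ μ x, g.dist (blk x) (blk (T μ x)) ≤ d₀)
    (hd₀FB : ∀ μ ν x, g.dist (blk x) (blk ((T ν).symm (T μ x))) ≤ d₀)
    (hd₀st : ∀ μ x (q : κ × S), q ∈ stBonds T μ x → g.dist (blk x) (blk q.2) ≤ d₀)
    (hd₀loc : ∀ μ x (q : κ × S), q ∈ B9Eq375Locality.locBondsA' T μ x → g.dist (blk x) (blk q.2) ≤ d₀)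
    (hd₀0 : ∀ y : g.Site, g.dist y y ≤ d₀)
    {v : g.Site → ℝ} (hv : ∀ y, 0 < v y) {c : ℝ} (hc : 0 < c)
    {Tr P₁ P₂ : Module.End ℝ ((κ × S) × ι → ℝ)}
    (hP₁ : HasMajorant (g := toB6 g Rr H) (fun q : (κ × S) × ι => blk q.1.2) P₁
      (fun a a' => κ₁ * α₁ * (g.len a ^ 2)⁻¹ * Real.exp (-(δ * g.dist a a'))))
    (hP₂ : HasMajorant (g := toB6 g Rr H) (fun q : (κ × S) × ι => blk q.1.2) P₂
      (fun a a' => κ₂ * α₁ * (g.len a ^ 2)⁻¹ * Real.exp (-(δ * g.dist a a'))))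
    (hTr : HasKernelBound (g := toB6 g Rr H) (fun q : (κ × S) × ι => blk q.1.2) v c Tr
      (fun a a' => B₀ * w a * Real.exp (-(δ * g.dist a a'))))
    (hDTr : ∀ k : κ ⊕ κ, HasKernelBound (g := toB6 g Rr H) (fun q : (κ × S) × ι => blk q.1.2) v c
      (conj b (diffLetter (bT T) (bU U) ((g.eta : ℂ)⁻¹) k) * Tr) (fun a a' => B₀ * (w a * (g.len a)⁻¹) * Real.exp (-(δ * g.dist a a')))) :
    HasKernelBound (g := toB6 g Rr H) (fun q : (κ × S) × ι => blk q.1.2) v c (vTotal (conj b (V₃Op T U g.eta A)) P₁ P₂ * Tr)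
      (fun a a' => kappa385 B₀ (cV385 (Fintype.card κ) α₁ C₀ (M₂ * (∑ i, ‖b i‖) * Real.exp (δ * d₀))) κ₁ κ₂ Λ (B6.c1 d δ₀ β) *
        α₁ * ((g.len a ^ 2)⁻¹ * w a) * Real.exp (-(ρ * g.dist a a'))) := by
  have hbsum : 0 ≤ ∑ i, ‖b i‖ := Finset.sum_nonneg fun i _ => norm_nonneg _
  have hM : 0 ≤ M₂ * (∑ i, ‖b i‖) * Real.exp (δ * d₀) := by positivity
  have hcV0 := cV0_nonneg (Fintype.card κ) hα₁ hC₀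
  have hcV := cV385_nonneg (Fintype.card κ) hα₁ hC₀ hM
  -- the discharged `V₃`-side inputs (verbatim from FILE 8)
  have hV₃ := conj_V₃Op_eq_gradForm T U b g.eta A
  have hV0 := hasMajorant_V₃_zero (Rr := Rr) (H := H) b T U blk hη hL A C₀ d₀ δ M₂ α₁ hα₁ hC₀ hδ hM₂ hrepr hlen hsmall hU1
    h337B h337F h337B' hAst hAloc hdAst h35 hd₀B hd₀F hd₀FB hd₀st hd₀loc hd₀0
  have hV1 := hasMajorant_V₃_one (Rr := Rr) (H := H) b T U blk A d₀ δ M₂ α₁ hα₁ hδ hM₂ hrepr hlen hA hAτB hAτF hU1 hd₀B hd₀F hd₀0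
  have hV0' : HasMajorant (g := toB6 g Rr H) (fun q : (κ × S) × ι => blk q.1.2)
      (conj b (zeroLetter T U ((g.eta : ℂ)⁻¹) A + F₁Letter T U g.eta A)
        - conj b (dPrimeLetter T (prodCfg U g.eta A) g.eta - dPrimeLetter T U g.eta)
        + conj b (zeroLetter₂ T U ((g.eta : ℂ)⁻¹) A + F₂Letter T U g.eta A))
      (fun a a' => cV385 (Fintype.card κ) α₁ C₀ (M₂ * (∑ i, ‖b i‖) * Real.exp (δ * d₀)) * α₁ * (g.len a ^ 2)⁻¹ *
        Real.exp (-(δ * g.dist a a'))) := by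
    refine hasMajorant_mono (g := toB6 g Rr H) _ hV0 fun y y' => ?_
    have h0 : 0 ≤ 28 * (Fintype.card κ : ℝ) * (Fintype.card κ + 1) * (M₂ * (∑ i, ‖b i‖) * Real.exp (δ * d₀)) * α₁ *
        (g.len y ^ 2)⁻¹ * Real.exp (-(δ * g.dist y y')) := by positivity
    have e : cV385 (Fintype.card κ) α₁ C₀ (M₂ * (∑ i, ‖b i‖) * Real.exp (δ * d₀)) * α₁ * (g.len y ^ 2)⁻¹ *
          Real.exp (-(δ * g.dist y y'))
        = cV0 (Fintype.card κ) α₁ C₀ * M₂ * (∑ i, ‖b i‖) * Real.exp (δ * d₀) * α₁ * (g.len y ^ 2)⁻¹ *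
            Real.exp (-(δ * g.dist y y'))
          + 28 * (Fintype.card κ : ℝ) * (Fintype.card κ + 1) * (M₂ * (∑ i, ‖b i‖) * Real.exp (δ * d₀)) * α₁ *
            (g.len y ^ 2)⁻¹ * Real.exp (-(δ * g.dist y y')) := by
      unfold cV385; ring
    rw [e]
    linarith
  have hsum : ∑ _k ∈ (Finset.univ : Finset (κ ⊕ κ)),
      14 * ((Fintype.card κ : ℝ) + 1) * M₂ * (∑ i, ‖b i‖) * Real.exp (δ * d₀)
        ≤ cV385 (Fintype.card κ) α₁ C₀ (M₂ * (∑ i, ‖b i‖) * Real.exp (δ * d₀)) := by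
    rw [Finset.sum_const, Finset.card_univ, Fintype.card_sum, nsmul_eq_mul, Nat.cast_add]
    have h0 : 0 ≤ cV0 (Fintype.card κ) α₁ C₀ * (M₂ * (∑ i, ‖b i‖) * Real.exp (δ * d₀)) := mul_nonneg hcV0 hM
    have e : cV385 (Fintype.card κ) α₁ C₀ (M₂ * (∑ i, ‖b i‖) * Real.exp (δ * d₀))
        = cV0 (Fintype.card κ) α₁ C₀ * (M₂ * (∑ i, ‖b i‖) * Real.exp (δ * d₀))
          + ((Fintype.card κ : ℝ) + Fintype.card κ) * (14 * ((Fintype.card κ : ℝ) + 1) * M₂ * (∑ i, ‖b i‖) *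
            Real.exp (δ * d₀)) := by
      unfold cV385; ring
    rw [e]
    linarith
  exact ineq385_kernel_sum (R := Rr) (H := H) (fun q : (κ × S) × ι => blk q.1.2) d Finset.univ δ₀ δ α β ρ Λ B₀
    (cV385 (Fintype.card κ) α₁ C₀ (M₂ * (∑ i, ‖b i‖) * Real.exp (δ * d₀))) κ₁ κ₂ α₁
    (fun _ => 14 * ((Fintype.card κ : ℝ) + 1) * M₂ * (∑ i, ‖b i‖) * Real.exp (δ * d₀)) w
    hB₀ hcV hκ₁ hκ₂ hα₁ hΛ hρ hα hβ hδ₀ hr hw (fun k _ => by positivity) hsum hdnn htri hlen h261 hT1 hT2 hv hc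
    (V1 := fun k => conj b (V1Letter T U A k) + conj b (V1Letter₂ T U A k))
    (D := fun k => conj b (diffLetter (bT T) (bU U) ((g.eta : ℂ)⁻¹) k))
    hV₃ hV0' (fun k _ => hV1 k) hP₁ hP₂ hTr (fun k _ => hDTr k)

end Concrete

end Literature.MathematicalPhysics.QuantumFieldTheory.Balaban1983to89.B9Ineq385KernelConcrete

end
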